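import Literature.Geometry.Lorentzian.TeukolskyHorizonSupPorts
import HarnessLib

/-!
# The horizon pocket of the scalar radial Teukolsky solution on a bounded frequency box, with
# constants that are powers of `κ⁻¹`
(namespace `Literature.Geometry.Lorentzian.Kerr`.)

Companion of `TeukolskyHorizonSupPorts.lean`. With `X = κ⁻¹ ≥ 4M` (`κ = Kerr.surfaceGravity M a`),
`d = r₊ − r₋ = 2κ(r₊² + a²)`, `σ = ω − mω₊`, `ξ = (2Mr₊/d)σ` and the port
`D(r) = ‖R r‖ + (r − r₊)‖R′ r‖` (`R′ = deriv R`), the two horizon-pocket ports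
`smallXi_pocket_port` (`|ξ| ≤ 1`) and `largeXi_pocket_port` (`|ξ| ≥ 1`) are brought to ONE
common shape — an edge `x₁ ≥ c₁ max(1, |ξ|)` with `r₊ + dx₁ ≤ R_F`,
`√(r² + a²)‖R r‖ ≤ K_P X⁹` on `r₊ < r ≤ r₊ + dx₁` and `D(r₊ + dx₁) ≤ K_P X⁹` — with a constant
`K_P` depending on the box `Λ ≤ Λ₁`, `M|ω| ≤ Λ₁` only, so that the Summits-side assembly of the
polynomial sup bound for the horizon-normalised solution (crux `KappaExplicitWaveDecay`, stub
`stub_horizonSupBoxPoly`) is pure plumbing: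

* `box_chart_constants`, `rPlus_sub_rMinus_mul_abs_xi` — chart constants of the sub-extremal box
  (`0 < d ≤ 4M`, `4M ≤ κ⁻¹`, `1/d ≤ κ⁻¹/(2M²)`, `d|ξ| = (r₊² + a²)|σ|`);
* `smallXi_pocket_box` — `|ξ| ≤ 1`, edge `x₁ = 1` (κ-free regular-singular energy);
* `largeXi_pocket_box` — `|ξ| > 1`, edge `x₁ = c₁|ξ|`, `c₁ = 1/(32Λ₁ + 48)` (Sonin on the pocket;
  the ratio `((ω² + 6Λ/M²)/(σ²/800))⁴ ≤ (200Φ₁)⁴X⁸` since `|σ| ≥ 2κ`).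

Everything is proved; no named fact is used. The blown-up normal form enters `smallXi_pocket_box`
as a HYPOTHESIS (the shape produced by the Summits-side `stub_olverNormalForm`).

## References
* R. Teixeira da Costa, CMP 378 (2020) 705–781 = arXiv:1910.02854, Def. 2.3. [Costa2019]
* M. Dafermos, I. Rodnianski, Y. Shlapentokh-Rothman, arXiv:1402.7034, §8.
  [DafermosRodnianskiShlapentokhrothman2014]
* R. M. Wald, *General Relativity* (Chicago 1984), §12.3, §12.5. [Wald1984GR]
-/

noncomputable section

namespace Literature.Geometry.Lorentzian

namespace Kerr

open Filter Set Complex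
open scoped _root_.Topology

/-! ### Arithmetic of the constants -/

/-- Absorbing a lower power: for `0 < L ≤ X` and `j ≤ k`, `X^j ≤ X^k / L^(k − j)`. [folklore] -/
private theorem pow_le_pow_div_pow {X L : ℝ} {j k : ℕ} (hL : 0 < L) (hX : L ≤ X) (hjk : j ≤ k) :
    X ^ j ≤ X ^ k / L ^ (k - j) := by
  have hX0 : 0 ≤ X := hL.le.trans hX
  rw [le_div_iff₀ (pow_pos hL _)]
  calc X ^ j * L ^ (k - j) ≤ X ^ j * X ^ (k - j) := by gcongr
    _ = X ^ k := by rw [← pow_add, Nat.add_sub_cancel' hjk]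

/-- The Sonin ratio of the `|ξ| > 1` pocket is a power of `X = κ⁻¹`: if `0 ≤ Φ ≤ Φ₁` and
`4/X² ≤ σ²` (`X > 0`) then `(Φ/(σ²/800))⁴ ≤ (200Φ₁)⁴ X⁸`. [folklore] -/
private theorem ratio_pow_le {Φ Φ₁ σ X : ℝ} (hΦ0 : 0 ≤ Φ) (hΦ : Φ ≤ Φ₁) (hX : 0 < X)
    (hσ : 4 / X ^ 2 ≤ σ ^ 2) :
    (Φ / (σ ^ 2 / 800)) ^ 4 ≤ (200 * Φ₁) ^ 4 * X ^ 8 := by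
  have hs : 0 < σ ^ 2 / 800 := by
    have : 0 < 4 / X ^ 2 := by positivity
    linarith
  have h1 : Φ / (σ ^ 2 / 800) ≤ 200 * Φ₁ * X ^ 2 := by
    rw [div_le_iff₀ hs]
    have h2 : 200 * Φ₁ * X ^ 2 * (4 / X ^ 2 / 800) = Φ₁ := by field_simp; ring
    have hΦ₁ : 0 ≤ 200 * Φ₁ * X ^ 2 := by nlinarith [hΦ0.trans hΦ, sq_nonneg X]
    calc Φ ≤ Φ₁ := hΦ
      _ = 200 * Φ₁ * X ^ 2 * (4 / X ^ 2 / 800) := h2.symm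
      _ ≤ 200 * Φ₁ * X ^ 2 * (σ ^ 2 / 800) := by
          apply mul_le_mul_of_nonneg_left _ hΦ₁
          exact div_le_div_of_nonneg_right hσ (by norm_num)
  calc (Φ / (σ ^ 2 / 800)) ^ 4 ≤ (200 * Φ₁ * X ^ 2) ^ 4 :=
        pow_le_pow_left₀ (div_nonneg hΦ0 hs.le) h1 4
    _ = (200 * Φ₁) ^ 4 * X ^ 8 := by ring

/-! ### Geometry of the sub-extremal box -/

/-- **Chart constants of the sub-extremal box.** For `0 < M`, `|a| < M`, with `d = r₊ − r₋` and
`κ = surfaceGravity M a`: `0 < d ≤ 4M`, `0 < κ`, `4M ≤ κ⁻¹`, `1/d ≤ κ⁻¹/(2M²)`,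
`M ≤ r₊ ≤ 2M`, `r₊² + a² ≤ 8M²`, `d = 2κ(r₊² + a²)` (`kerr_box_geometry`; Wald 1984, §12.3, §12.5).
[folklore] -/
theorem box_chart_constants {M a : ℝ} (hM : 0 < M) (ha : |a| < M) :
    0 < rPlus M a - rMinus M a ∧ rPlus M a - rMinus M a ≤ 4 * M ∧
      0 < surfaceGravity M a ∧ 4 * M ≤ (surfaceGravity M a)⁻¹ ∧
      1 / (rPlus M a - rMinus M a) ≤ (surfaceGravity M a)⁻¹ / (2 * M ^ 2) ∧
      M ≤ rPlus M a ∧ rPlus M a ≤ 2 * M ∧ rPlus M a ^ 2 + a ^ 2 ≤ 8 * M ^ 2 ∧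
      rPlus M a - rMinus M a =
        2 * surfaceGravity M a * (rPlus M a ^ 2 + a ^ 2) := by
  obtain ⟨hκ, hκ4, hdκ, hAM, hA8, hMr, hr2⟩ := kerr_box_geometry hM ha
  have hrp0 : 0 < rPlus M a := rPlus_pos hM a
  have hA0 : 0 < rPlus M a ^ 2 + a ^ 2 := by positivity
  have hd : 0 < rPlus M a - rMinus M a :=
    sub_pos.2 (IsSubextremal.rMinus_lt_rPlus ha)
  have hX4 : 4 * M ≤ (surfaceGravity M a)⁻¹ := by
    rw [le_inv_comm₀ (by positivity) hκ, ← one_div]; exact hκ4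
  have hXκ : (surfaceGravity M a)⁻¹ * surfaceGravity M a = 1 := inv_mul_cancel₀ hκ.ne'
  refine ⟨hd, ?_, hκ, hX4, ?_, hMr, hr2, hA8, hdκ⟩
  · rw [hdκ]
    calc 2 * surfaceGravity M a * (rPlus M a ^ 2 + a ^ 2)
        ≤ 2 * (1 / (4 * M)) * (8 * M ^ 2) := by gcongr
      _ = 4 * M := by field_simp; ring
  · rw [hdκ, div_le_div_iff₀ (by positivity) (by positivity)]
    have e : (surfaceGravity M a)⁻¹ *
        (2 * surfaceGravity M a * (rPlus M a ^ 2 + a ^ 2)) =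
        2 * (rPlus M a ^ 2 + a ^ 2) := by
      linear_combination (2 * (rPlus M a ^ 2 + a ^ 2)) * hXκ
    rw [e]; linarith

/-- **`d|ξ| = (r₊² + a²)|σ|`**: with `d = r₊ − r₋`, `σ = ω − mω₊`, `ξ = (2Mr₊/d)σ` and
`r₊² + a² = 2Mr₊` (`rPlus_sq_add_sq`; Wald 1984, §12.3). [folklore] -/
theorem rPlus_sub_rMinus_mul_abs_xi {M a : ℝ} (hM : 0 < M) (ha : |a| < M) (ω : ℝ) (m : ℤ) :
    (rPlus M a - rMinus M a) *
        |2 * M * rPlus M a / (rPlus M a - rMinus M a) *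
          (ω - m * horizonAngularVelocity M a)| =
      (rPlus M a ^ 2 + a ^ 2) * |ω - m * horizonAngularVelocity M a| := by
  have hd : 0 < rPlus M a - rMinus M a :=
    sub_pos.2 (IsSubextremal.rMinus_lt_rPlus ha)
  have hrp0 : 0 < rPlus M a := rPlus_pos hM a
  rw [rPlus_sq_add_sq ha.le, abs_mul, abs_div,
    abs_of_pos (by positivity : 0 < 2 * M * rPlus M a), abs_of_pos hd, ← mul_assoc,
    mul_div_cancel₀ _ hd.ne']

/-! ### The horizon pocket in the port -/

/-- **The `|ξ| ≤ 1` pocket, box form with edge `x₁ = 1`.** Under the hypotheses of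
`smallXi_pocket_port` (`R` a classical radial solution normalised at `𝓗⁺`, Teixeira da Costa
Def. 2.3, with derivative witnesses of the blown-up normal form): `√(r² + a²)‖R r‖ ≤ 5M√B₁` on
`r₊ < r ≤ r₊ + d` and `D(r₊ + d) ≤ 7√B₁`; both are `≤ (5M + 7)√B₁ ≤ K_P X⁹` as soon as
`(5M + 7)√B₁/(4M)⁹ ≤ K_P` and `(4M)⁹ ≤ X⁹` (`S₁ = √B₁`); moreover `r₊ + d ≤ 6M ≤ R_F` and
`c₁|ξ| ≤ 1` for `c₁ ≤ 1`. [cite: Costa2019, Definition 2.3] -/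
theorem smallXi_pocket_box {M a ω Λ Λ₁ c₁ RF S₁ KP X : ℝ} {m : ℤ} (hM : 0 < M) (ha : |a| < M)
    (hadm : IsAdmissibleTriple a ω m Λ) (hΛ₁ : Λ ≤ Λ₁) (hMω : M * |ω| ≤ Λ₁)
    (hξ : |2 * M * rPlus M a / (rPlus M a - rMinus M a) *
        (ω - m * horizonAngularVelocity M a)| ≤ 1)
    {R : ℝ → ℂ} (hR : IsRadialTeukolskySolution M a 0 ω m (Λ - a ^ 2 * ω ^ 2) R)
    (hn : IsNormalisedHorizonSolution M a 0 ω m R) {W' W'' : ℝ → ℂ}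
    (hW : ∀ x : ℝ, 0 < x →
      HasDerivAt (fun y : ℝ ↦ ((Real.sqrt (y * (y + 1)) : ℝ) : ℂ) *
          R (rPlus M a + (rPlus M a - rMinus M a) * y)) (W' x) x ∧
        HasDerivAt W' (W'' x) x ∧
        W'' x =
          ((((Λ - 2 * a * m * ω) * (x * (x + 1)) -
                  (radialK a ω m (rPlus M a + (rPlus M a - rMinus M a) * x) /
                      (rPlus M a - rMinus M a)) ^ 2 - 1 / 4) /
                (x * (x + 1)) ^ 2 : ℝ) : ℂ) *
            (((Real.sqrt (x * (x + 1)) : ℝ) : ℂ) *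
              R (rPlus M a + (rPlus M a - rMinus M a) * x)))
    (hc₁ : c₁ ≤ 1) (hRF : 7 * M ≤ RF) (hX : (4 * M) ^ 9 ≤ X ^ 9)
    (hS₁ : S₁ = Real.sqrt (Real.exp ((1 + (4 * Λ₁ + 6 * Λ₁ * (2 + 6 * Λ₁) + 15 / 4)) ^ 2) /
      M ^ 2))
    (hKP : (5 * M + 7) * S₁ / (4 * M) ^ 9 ≤ KP) :
    ∃ x₁ : ℝ, c₁ ≤ x₁ ∧
      c₁ * |2 * M * rPlus M a / (rPlus M a - rMinus M a) *
          (ω - m * horizonAngularVelocity M a)| ≤ x₁ ∧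
      rPlus M a + (rPlus M a - rMinus M a) * x₁ ≤ RF ∧
      (∀ r : ℝ, rPlus M a < r →
          r ≤ rPlus M a + (rPlus M a - rMinus M a) * x₁ →
            Real.sqrt (r ^ 2 + a ^ 2) * ‖R r‖ ≤ KP * X ^ 9) ∧
      ‖R (rPlus M a + (rPlus M a - rMinus M a) * x₁)‖ +
          (rPlus M a - rMinus M a) * x₁ *
            ‖deriv R (rPlus M a + (rPlus M a - rMinus M a) * x₁)‖ ≤
        KP * X ^ 9 := by
  have hRd : ∀ s, rPlus M a < s → DifferentiableAt ℝ R s := by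
    obtain ⟨R', R'', h⟩ := hR
    exact fun s hs ↦ (h s hs).1.differentiableAt
  obtain ⟨hreg, hprt⟩ := smallXi_pocket_port hM ha hadm hΛ₁ hMω hξ hRd hn hW
  rw [← hS₁] at hreg hprt
  obtain ⟨hd, hd4, -, -, -, -, hr2, -, -⟩ := box_chart_constants hM ha
  have hS0 : 0 ≤ S₁ := by rw [hS₁]; exact Real.sqrt_nonneg _
  have hM4 : 0 < (4 * M) ^ 9 := by positivity
  have h57 : 0 ≤ (5 * M + 7) * S₁ := by positivity
  have hKP' : (5 * M + 7) * S₁ ≤ KP * (4 * M) ^ 9 := (div_le_iff₀ hM4).1 hKP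
  have hKP0 : 0 ≤ KP := le_of_mul_le_mul_right (by rw [zero_mul]; exact h57.trans hKP') hM4
  have hKP1 : (5 * M + 7) * S₁ ≤ KP * X ^ 9 := hKP'.trans (mul_le_mul_of_nonneg_left hX hKP0)
  have h5 : 5 * M * S₁ ≤ (5 * M + 7) * S₁ := by nlinarith
  have h7 : 7 * S₁ ≤ (5 * M + 7) * S₁ := by nlinarith
  refine ⟨1, hc₁, ?_, by linarith, fun r hr hr1 ↦ ?_, hprt.trans (h7.trans hKP1)⟩
  · calc _ ≤ (1 : ℝ) * 1 := mul_le_mul hc₁ hξ (abs_nonneg _) zero_le_one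
      _ = 1 := one_mul _
  · obtain ⟨x, rfl⟩ : ∃ x : ℝ, r = rPlus M a + (rPlus M a - rMinus M a) * x :=
      ⟨(r - rPlus M a) / (rPlus M a - rMinus M a), by
        rw [mul_div_cancel₀ _ hd.ne']; ring⟩
    have hdx : 0 < (rPlus M a - rMinus M a) * x := by linarith
    have hx0 : 0 < x := pos_of_mul_pos_right hdx hd.le
    have hx1 : x ≤ 1 := le_of_mul_le_mul_left (by linarith) hd
    exact (hreg x ⟨hx0, hx1⟩).trans (h5.trans hKP1)

/-- **The `|ξ| > 1` pocket, box form with edge `x₁ = c₁|ξ|` (`dx₁ = ℓ = c₁|σ|(r₊² + a²) ≤ M`).**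
From `largeXi_pocket_port` with `c₁ = 1/(32Λ₁ + 48)` (so `10M|ω|c₁ ≤ 1`, `16(2Λ + 3)c₁ ≤ 1`) in
the cone `|σ| ≤ ε₀√Λ₁`, `ε₀ ≤ 1/(16M) ⊓ 1/(8Mc₁√Λ₁)`: `√(r² + a²)‖R r‖ ≤ 49P` on the pocket and
`D(r₊ + ℓ) ≤ P(98/M + 28M|σ|/d)`, where the Sonin ratio `P = ((ω² + 6Λ/M²)/(σ²/800))⁴` is
`≤ (200Φ₁)⁴X⁸` (`|σ| ≥ 2κ = 2/X`, `X = κ⁻¹`), `X⁸ ≤ X⁹/(4M)` and `|σ|/d ≤ √Λ₁X/(32M³)`;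
everything is `≤ K_P X⁹` once `(200Φ₁)⁴(49/(4M) + 98/(4M²) + √Λ₁/M²) ≤ K_P`. [folklore] -/
theorem largeXi_pocket_box {M a ω Λ Λ₁ c₁ ε₀ RF Φ₁ KP X : ℝ} {m : ℤ} (hM : 0 < M)
    (ha : |a| < M) (hadm : IsAdmissibleTriple a ω m Λ) (hΛ1 : 1 ≤ Λ) (hΛ₁ : Λ ≤ Λ₁)
    (hωM : |ω| ≤ Λ₁ / M) (hc₁ : c₁ = 1 / (32 * Λ₁ + 48)) (hε₀ : 0 < ε₀)
    (hσε : |ω - m * horizonAngularVelocity M a| ≤ ε₀ * Real.sqrt Λ₁)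
    (hε₁ : ε₀ ≤ 1 / (16 * M)) (hε₂ : ε₀ ≤ 1 / (8 * M * c₁ * Real.sqrt Λ₁)) (hRF : 7 * M ≤ RF)
    (hξ : 1 < |2 * M * rPlus M a / (rPlus M a - rMinus M a) *
        (ω - m * horizonAngularVelocity M a)|)
    {R : ℝ → ℂ} (hR : IsRadialTeukolskySolution M a 0 ω m (Λ - a ^ 2 * ω ^ 2) R)
    (hn : IsNormalisedHorizonSolution M a 0 ω m R) (hX : X = (surfaceGravity M a)⁻¹)
    (hΦ₁ : (Λ₁ / M) ^ 2 + 6 * Λ₁ / M ^ 2 ≤ Φ₁)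
    (hKP : (200 * Φ₁) ^ 4 * (49 / (4 * M) + 98 / (4 * M ^ 2) + Real.sqrt Λ₁ / M ^ 2) ≤ KP) :
    ∃ x₁ : ℝ, c₁ ≤ x₁ ∧
      c₁ * |2 * M * rPlus M a / (rPlus M a - rMinus M a) *
          (ω - m * horizonAngularVelocity M a)| ≤ x₁ ∧
      rPlus M a + (rPlus M a - rMinus M a) * x₁ ≤ RF ∧
      (∀ r : ℝ, rPlus M a < r →
          r ≤ rPlus M a + (rPlus M a - rMinus M a) * x₁ →
            Real.sqrt (r ^ 2 + a ^ 2) * ‖R r‖ ≤ KP * X ^ 9) ∧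
      ‖R (rPlus M a + (rPlus M a - rMinus M a) * x₁)‖ +
          (rPlus M a - rMinus M a) * x₁ *
            ‖deriv R (rPlus M a + (rPlus M a - rMinus M a) * x₁)‖ ≤
        KP * X ^ 9 := by
  obtain ⟨hd, hd4, hκ, hX4, hdinv, hMr, hr2, hA8, hdκ⟩ := box_chart_constants hM ha
  have hdξ := rPlus_sub_rMinus_mul_abs_xi hM ha ω m
  have hlarge := fun hc₀ hc₁' hcω hcΛ hσAp hℓM ↦
    largeXi_pocket_port (c₁ := c₁) hM ha hadm hΛ1 hc₀ hc₁' hcω hcΛ hσAp hℓM hR hn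
  rw [← hX] at hX4 hdinv
  /- abbreviations -/
  set κ := surfaceGravity M a with hκ_def
  set d := rPlus M a - rMinus M a with hd_def
  set Ap := rPlus M a ^ 2 + a ^ 2 with hAp
  set rp := rPlus M a with hrp
  set σ := ω - m * horizonAngularVelocity M a with hσ
  set ξ := 2 * M * rp / d * σ with hξ_def
  have hΛ₁1 : 1 ≤ Λ₁ := hΛ1.trans hΛ₁
  have hΛ0 : 0 ≤ Λ := zero_le_one.trans hΛ1
  have hc₁0 : 0 < c₁ := by rw [hc₁]; positivity
  have hc₁1 : c₁ ≤ 1 := by rw [hc₁, div_le_one (by positivity)]; linarith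
  have hsΛ₁ : 0 < Real.sqrt Λ₁ := Real.sqrt_pos.2 (by linarith)
  have hX0 : 0 < X := lt_of_lt_of_le (by positivity) hX4
  have hrp0 : 0 < rp := rPlus_pos hM a
  have hAp0 : 0 < Ap := by positivity
  have hX89 : X ^ 8 ≤ X ^ 9 / (4 * M) := by
    simpa using pow_le_pow_div_pow (by positivity : 0 < 4 * M) hX4 (by norm_num : 8 ≤ 9)
  -- `d ≤ |σ|(r₊² + a²)`, `σ ≠ 0`
  have hσAp : d ≤ |σ| * Ap := by
    have h1 : d * 1 ≤ d * |ξ| := mul_le_mul_of_nonneg_left hξ.le hd.le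
    rw [mul_one, hdξ, mul_comm] at h1
    exact h1
  have hσ0 : 0 < |σ| := by
    rcases (abs_nonneg σ).eq_or_lt with h | h
    · rw [← h, zero_mul] at hσAp
      linarith
    · exact h
  set ℓ := c₁ * |σ| * Ap with hℓ
  have hℓ0 : 0 < ℓ := mul_pos (mul_pos hc₁0 hσ0) hAp0
  have hdx₁ : d * (c₁ * |ξ|) = ℓ := by
    rw [hℓ, show d * (c₁ * |ξ|) = c₁ * (d * |ξ|) by ring, hdξ]; ring
  -- `ℓ ≤ M`
  have hℓM : ℓ ≤ M := by
    have h1 : ℓ ≤ c₁ * (ε₀ * Real.sqrt Λ₁) * (8 * M ^ 2) := by rw [hℓ]; gcongr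
    have h2 : c₁ * (ε₀ * Real.sqrt Λ₁) * (8 * M ^ 2) ≤
        c₁ * (1 / (8 * M * c₁ * Real.sqrt Λ₁) * Real.sqrt Λ₁) * (8 * M ^ 2) := by gcongr
    have h3 : c₁ * (1 / (8 * M * c₁ * Real.sqrt Λ₁) * Real.sqrt Λ₁) * (8 * M ^ 2) = M := by
      field_simp
    linarith
  -- the `c₁`-conditions of the Sonin pocket
  have hcω : 10 * M * |ω| * c₁ ≤ 1 := by
    have hMω : M * |ω| ≤ Λ₁ := by
      have h := mul_le_mul_of_nonneg_left hωM hM.le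
      rwa [mul_div_cancel₀ _ hM.ne'] at h
    have h1 : 10 * M * |ω| * c₁ ≤ 10 * Λ₁ * c₁ := by
      have h := mul_le_mul_of_nonneg_right hMω hc₁0.le
      linarith
    have h2 : 10 * Λ₁ * c₁ ≤ 1 := by
      rw [hc₁, mul_one_div, div_le_one (by positivity)]; linarith
    linarith
  have hcΛ : 16 * (2 * Λ + 3) * c₁ ≤ 1 := by
    have h1 : 16 * (2 * Λ + 3) * c₁ ≤ 16 * (2 * Λ₁ + 3) * c₁ := by gcongr
    have h2 : 16 * (2 * Λ₁ + 3) * c₁ = 1 := by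
      rw [hc₁, mul_one_div, div_eq_one_iff_eq (by positivity)]; ring
    linarith
  obtain ⟨hreg, hprt⟩ := hlarge hc₁0 hc₁1 hcω hcΛ hσAp hℓM
  -- the Sonin ratio is a power of `X`
  set P := ((ω ^ 2 + 6 * Λ / M ^ 2) / (σ ^ 2 / 800)) ^ 4 with hP
  have hΦ0 : 0 ≤ (200 * Φ₁) ^ 4 := by
    have : 0 ≤ Φ₁ := le_trans (by positivity) hΦ₁
    positivity
  have hPX : P ≤ (200 * Φ₁) ^ 4 * X ^ 8 := by
    rw [hP]
    refine ratio_pow_le (by positivity) ?_ hX0 ?_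
    · -- `ω² + 6Λ/M² ≤ Φ₁`
      have h1 : ω ^ 2 ≤ (Λ₁ / M) ^ 2 := by
        rw [← sq_abs ω]; exact pow_le_pow_left₀ (abs_nonneg _) hωM 2
      have h2 : 6 * Λ / M ^ 2 ≤ 6 * Λ₁ / M ^ 2 := by gcongr
      linarith
    · -- `4/X² ≤ σ²`
      have h2κ : 2 * κ ≤ |σ| :=
        le_of_mul_le_mul_right (by rw [← hdκ]; exact hσAp) hAp0
      have e : 4 / X ^ 2 = (2 * κ) ^ 2 := by
        rw [hX, inv_pow, div_eq_mul_inv, inv_inv]; ring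
      rw [e, ← sq_abs σ]
      exact pow_le_pow_left₀ (by positivity) h2κ 2
  have h49 : 49 * P ≤ (200 * Φ₁) ^ 4 * (49 / (4 * M)) * X ^ 9 :=
    calc 49 * P ≤ 49 * ((200 * Φ₁) ^ 4 * X ^ 8) := by gcongr
      _ ≤ 49 * ((200 * Φ₁) ^ 4 * (X ^ 9 / (4 * M))) := by gcongr
      _ = (200 * Φ₁) ^ 4 * (49 / (4 * M)) * X ^ 9 := by ring
  -- `|σ|/d ≤ √Λ₁ X/(32M³)`
  have hσd : |σ| / d ≤ Real.sqrt Λ₁ * X / (32 * M ^ 3) := by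
    have h1 : |σ| / d ≤ (ε₀ * Real.sqrt Λ₁) * (X / (2 * M ^ 2)) := by
      rw [div_eq_mul_one_div]
      exact mul_le_mul hσε hdinv (by positivity) (by positivity)
    have h2 : (ε₀ * Real.sqrt Λ₁) * (X / (2 * M ^ 2)) ≤
        (1 / (16 * M) * Real.sqrt Λ₁) * (X / (2 * M ^ 2)) := by gcongr
    have h3 : (1 / (16 * M) * Real.sqrt Λ₁) * (X / (2 * M ^ 2)) =
        Real.sqrt Λ₁ * X / (32 * M ^ 3) := by ring
    linarith
  have hterm1 : P * (98 / M) ≤ (200 * Φ₁) ^ 4 * (98 / (4 * M ^ 2)) * X ^ 9 :=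
    calc P * (98 / M) ≤ (200 * Φ₁) ^ 4 * X ^ 8 * (98 / M) := by gcongr
      _ ≤ (200 * Φ₁) ^ 4 * (X ^ 9 / (4 * M)) * (98 / M) := by gcongr
      _ = (200 * Φ₁) ^ 4 * (98 / (4 * M ^ 2)) * X ^ 9 := by ring
  have hterm2 : P * (28 * M * |σ| / d) ≤ (200 * Φ₁) ^ 4 * (Real.sqrt Λ₁ / M ^ 2) * X ^ 9 := by
    have h1 : 28 * M * |σ| / d ≤ Real.sqrt Λ₁ / M ^ 2 * X := by
      rw [mul_div_assoc]
      calc 28 * M * (|σ| / d) ≤ 28 * M * (Real.sqrt Λ₁ * X / (32 * M ^ 3)) := by gcongr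
        _ = (28 / 32) * (Real.sqrt Λ₁ / M ^ 2 * X) := by field_simp
        _ ≤ 1 * (Real.sqrt Λ₁ / M ^ 2 * X) :=
            mul_le_mul_of_nonneg_right (by norm_num) (by positivity)
        _ = Real.sqrt Λ₁ / M ^ 2 * X := one_mul _
    calc P * (28 * M * |σ| / d) ≤ ((200 * Φ₁) ^ 4 * X ^ 8) * (Real.sqrt Λ₁ / M ^ 2 * X) :=
          mul_le_mul hPX h1 (by positivity) (by positivity)
      _ = (200 * Φ₁) ^ 4 * (Real.sqrt Λ₁ / M ^ 2) * X ^ 9 := by ring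
  have hX90 : 0 ≤ X ^ 9 := by positivity
  have hK1 : 0 ≤ 49 / (4 * M) := by positivity
  have hK2 : 0 ≤ 98 / (4 * M ^ 2) := by positivity
  have hK3 : 0 ≤ Real.sqrt Λ₁ / M ^ 2 := by positivity
  have hKPX : (200 * Φ₁) ^ 4 * (49 / (4 * M) + 98 / (4 * M ^ 2) + Real.sqrt Λ₁ / M ^ 2) * X ^ 9 ≤
      KP * X ^ 9 := mul_le_mul_of_nonneg_right hKP hX90
  refine ⟨c₁ * |ξ|, le_mul_of_one_le_right hc₁0.le hξ.le, le_rfl, ?_, fun r hr hr1 ↦ ?_, ?_⟩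
  · rw [hdx₁]; linarith
  · rw [hdx₁] at hr1
    calc _ ≤ 49 * P := hreg r hr (by linarith)
      _ ≤ (200 * Φ₁) ^ 4 * (49 / (4 * M)) * X ^ 9 := h49
      _ ≤ (200 * Φ₁) ^ 4 * (49 / (4 * M) + 98 / (4 * M ^ 2) + Real.sqrt Λ₁ / M ^ 2) * X ^ 9 := by
          apply mul_le_mul_of_nonneg_right _ hX90
          apply mul_le_mul_of_nonneg_left _ hΦ0
          linarith
      _ ≤ KP * X ^ 9 := hKPX
  · rw [hdx₁]
    calc _ ≤ P * (98 / M + 28 * M * |σ| / d) := hprt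
      _ = P * (98 / M) + P * (28 * M * |σ| / d) := by ring
      _ ≤ (200 * Φ₁) ^ 4 * (98 / (4 * M ^ 2)) * X ^ 9 +
          (200 * Φ₁) ^ 4 * (Real.sqrt Λ₁ / M ^ 2) * X ^ 9 := add_le_add hterm1 hterm2
      _ = (200 * Φ₁) ^ 4 * (98 / (4 * M ^ 2) + Real.sqrt Λ₁ / M ^ 2) * X ^ 9 := by ring
      _ ≤ (200 * Φ₁) ^ 4 * (49 / (4 * M) + 98 / (4 * M ^ 2) + Real.sqrt Λ₁ / M ^ 2) * X ^ 9 := by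
          apply mul_le_mul_of_nonneg_right _ hX90
          apply mul_le_mul_of_nonneg_left _ hΦ0
          linarith
      _ ≤ KP * X ^ 9 := hKPX

end Kerr

end Literature.Geometry.Lorentzian

end
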